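/-
Copyright: b2b-lace packet (numerics seat num1, gen 17).  Elementary two-sided bracket for the
truncated binomial series of `(1 - y)^{-1/2}` — ingredient L4(a) of the Poisson-split seed
certificate (`num1/SEEDCERT_U_g17.md`), where it brackets `(1 - s²)^{-1/2}` on `[0, s₀]` inside
the Laplace-type integral `e^{-u} I_a(u) = (2/π) ∫₀¹ e^{-2us²} T_a(1-2s²) (1-s²)^{-1/2} ds`.
-/
import Mathlib.Analysis.Calculus.Deriv.MeanValue
import Mathlib.Analysis.SpecialFunctions.Sqrt
import Mathlib.Data.Nat.Choose.Central
import HarnessLib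

/-!
# Two-sided bracket for the partial sums of `(1 - y)^{-1/2} = Σ_j C(2j,j) 4^{-j} y^j`

For `0 ≤ y < 1` and every `J`,
`B_J(y) ≤ (1 - y)^{-1/2} ≤ B_J(y) + β_{J+1} y^{J+1} / (1 - y)`, `B_J(y) = Σ_{j ≤ J} β_j y^j`,
`β_j = C(2j,j)/4^j` ([folklore]; the generating function of the central binomial coefficients).
The proof is series-free: with `g(t) = 1 - √(1-t) B_J(t)` one has `g(0) = 0` and
`g'(t) = (2J+1) β_J t^J / (2 √(1-t)) ≥ 0` from the polynomial identity
`2 (1 - t) B_J'(t) = B_J(t) - (2J+1) β_J t^J` (`invSqrtPartial_identity`), whence the lower bound by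
monotonicity; and `t ↦ g(t) - β_{J+1} t^{J+1} / √(1-y)` is antitone on `[0, y]` because
`(J+1) β_{J+1} = (2J+1) β_J / 2` and `√(1-t) ≥ √(1-y)`, whence the upper bound.

* `invSqrtCoeff`, `invSqrtPartial`, `invSqrtPartialDeriv` — `β_j`, `B_J`, `B_J'`;
* `invSqrtPartial_le_inv_sqrt` — `B_J(y) ≤ (√(1-y))⁻¹`;
* `inv_sqrt_le_invSqrtPartial_add` — `(√(1-y))⁻¹ ≤ B_J(y) + β_{J+1} y^{J+1}/(1-y)`.
-/

namespace Literature.Probability.FitznerVanDerHofstad2017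

open Finset Real Set

/-- `β_j = C(2j,j) / 4^j`, the `j`-th Taylor coefficient of `(1 - y)^{-1/2}` at `0`. [folklore] -/
noncomputable def invSqrtCoeff (j : ℕ) : ℝ := (Nat.centralBinom j : ℝ) / 4 ^ j

/-- `B_J(y) = Σ_{j ≤ J} β_j y^j`, the degree-`J` Taylor polynomial of `(1 - y)^{-1/2}`. [folklore] -/
noncomputable def invSqrtPartial (J : ℕ) (y : ℝ) : ℝ :=
  ∑ j ∈ range (J + 1), invSqrtCoeff j * y ^ j

/-- `B_J'(y) = Σ_{j < J} (j+1) β_{j+1} y^j`. [folklore] -/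
noncomputable def invSqrtPartialDeriv (J : ℕ) (y : ℝ) : ℝ :=
  ∑ j ∈ range J, ((j : ℝ) + 1) * invSqrtCoeff (j + 1) * y ^ j

/-- `β_0 = 1`. [folklore] -/
theorem invSqrtCoeff_zero : invSqrtCoeff 0 = 1 := by
  simp [invSqrtCoeff]

/-- `β_j > 0`. [folklore] -/
theorem invSqrtCoeff_pos (j : ℕ) : 0 < invSqrtCoeff j := by
  unfold invSqrtCoeff
  have : 0 < (Nat.centralBinom j : ℝ) := by exact_mod_cast Nat.centralBinom_pos j
  positivity

/-- the recursion `2 (j+1) β_{j+1} = (2j+1) β_j`. [folklore] -/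
theorem invSqrtCoeff_succ (j : ℕ) :
    2 * ((j : ℝ) + 1) * invSqrtCoeff (j + 1) = (2 * (j : ℝ) + 1) * invSqrtCoeff j := by
  have h : ((j : ℝ) + 1) * (Nat.centralBinom (j + 1) : ℝ)
      = 2 * (2 * (j : ℝ) + 1) * (Nat.centralBinom j : ℝ) := by
    exact_mod_cast Nat.succ_mul_centralBinom_succ j
  have h4 : (4 : ℝ) ^ j ≠ 0 := pow_ne_zero _ (by norm_num)
  unfold invSqrtCoeff
  rw [pow_succ]
  field_simp
  linear_combination 2 * h

/-- `B_J(0) = 1`. [folklore] -/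
theorem invSqrtPartial_zero_right (J : ℕ) : invSqrtPartial J 0 = 1 := by
  unfold invSqrtPartial
  rw [sum_range_succ']
  simp [invSqrtCoeff_zero]

/-- `B_{J+1}(y) = B_J(y) + β_{J+1} y^{J+1}`. [folklore] -/
theorem invSqrtPartial_succ (J : ℕ) (y : ℝ) :
    invSqrtPartial (J + 1) y = invSqrtPartial J y + invSqrtCoeff (J + 1) * y ^ (J + 1) := by
  simp [invSqrtPartial, sum_range_succ _ (J + 1)]

/-- `B_{J+1}'(y) = B_J'(y) + (J+1) β_{J+1} y^J`. [folklore] -/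
theorem invSqrtPartialDeriv_succ (J : ℕ) (y : ℝ) :
    invSqrtPartialDeriv (J + 1) y
      = invSqrtPartialDeriv J y + ((J : ℝ) + 1) * invSqrtCoeff (J + 1) * y ^ J := by
  simp [invSqrtPartialDeriv, sum_range_succ]

/-- `B_J(y) ≥ 0` for `y ≥ 0`. [folklore] -/
theorem invSqrtPartial_nonneg (J : ℕ) {y : ℝ} (hy : 0 ≤ y) : 0 ≤ invSqrtPartial J y :=
  sum_nonneg fun j _ => mul_nonneg (invSqrtCoeff_pos j).le (pow_nonneg hy j)

/-- the polynomial identity `2 (1 - y) B_J'(y) = B_J(y) - (2J+1) β_J y^J`. [folklore] -/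
theorem invSqrtPartial_identity (J : ℕ) (y : ℝ) :
    2 * (1 - y) * invSqrtPartialDeriv J y
      = invSqrtPartial J y - (2 * (J : ℝ) + 1) * invSqrtCoeff J * y ^ J := by
  induction J with
  | zero => simp [invSqrtPartialDeriv, invSqrtPartial, invSqrtCoeff_zero]
  | succ J ih =>
    rw [invSqrtPartialDeriv_succ, invSqrtPartial_succ]
    have hc := invSqrtCoeff_succ J
    push_cast
    linear_combination ih + y ^ J * hc

/-- `B_J` has derivative `B_J'`. [folklore] -/
theorem hasDerivAt_invSqrtPartial (J : ℕ) (y : ℝ) :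
    HasDerivAt (invSqrtPartial J) (invSqrtPartialDeriv J y) y := by
  induction J with
  | zero =>
    have h0 : invSqrtPartial 0 = fun _ => (1 : ℝ) := by
      funext t; simp [invSqrtPartial, invSqrtCoeff_zero]
    rw [h0]
    simpa [invSqrtPartialDeriv] using hasDerivAt_const y (1 : ℝ)
  | succ J ih =>
    have hs : invSqrtPartial (J + 1)
        = fun t => invSqrtPartial J t + invSqrtCoeff (J + 1) * t ^ (J + 1) := by
      funext t; exact invSqrtPartial_succ J t
    rw [hs, invSqrtPartialDeriv_succ]
    have hp := (hasDerivAt_pow (J + 1) y).const_mul (invSqrtCoeff (J + 1))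
    refine (ih.add hp).congr_deriv ?_
    push_cast
    ring

/-- the auxiliary function `g(t) = 1 - √(1-t) B_J(t)`. [folklore] -/
noncomputable def invSqrtGap (J : ℕ) (t : ℝ) : ℝ := 1 - √(1 - t) * invSqrtPartial J t

/-- `g(0) = 0`. [folklore] -/
theorem invSqrtGap_zero (J : ℕ) : invSqrtGap J 0 = 0 := by
  simp [invSqrtGap, invSqrtPartial_zero_right]

/-- `g'(t) = (2J+1) β_J t^J / (2 √(1-t))` for `t < 1`. [folklore] -/
theorem hasDerivAt_invSqrtGap (J : ℕ) {t : ℝ} (ht : t < 1) :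
    HasDerivAt (invSqrtGap J)
      ((2 * (J : ℝ) + 1) * invSqrtCoeff J * t ^ J / (2 * √(1 - t))) t := by
  have h1 : 0 < 1 - t := by linarith
  have hsq : HasDerivAt (fun s => √(1 - s)) ((-1) / (2 * √(1 - t))) t := by
    have := ((hasDerivAt_id t).const_sub 1).sqrt h1.ne'
    simpa using this
  have hprod := hsq.mul (hasDerivAt_invSqrtPartial J t)
  have hg := hprod.const_sub 1
  have hs : 0 < √(1 - t) := sqrt_pos.mpr h1
  have hss : √(1 - t) * √(1 - t) = 1 - t := mul_self_sqrt h1.le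
  have hid := invSqrtPartial_identity J t
  have e1 : √(1 - t) * invSqrtPartialDeriv J t
      = 2 * (1 - t) * invSqrtPartialDeriv J t / (2 * √(1 - t)) := by
    rw [eq_div_iff (by positivity)]
    linear_combination 2 * invSqrtPartialDeriv J t * hss
  have e : -((-1) / (2 * √(1 - t)) * invSqrtPartial J t + √(1 - t) * invSqrtPartialDeriv J t)
      = (2 * (J : ℝ) + 1) * invSqrtCoeff J * t ^ J / (2 * √(1 - t)) := by
    rw [e1, show (2 * (J : ℝ) + 1) * invSqrtCoeff J * t ^ J
        = invSqrtPartial J t - 2 * (1 - t) * invSqrtPartialDeriv J t by linarith [hid]]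
    ring
  show HasDerivAt (fun s => 1 - √(1 - s) * invSqrtPartial J s) _ t
  exact hg.congr_deriv e

/-- `g` is continuous on `(-∞, 1)`. [folklore] -/
theorem continuousOn_invSqrtGap (J : ℕ) : ContinuousOn (invSqrtGap J) (Iio 1) :=
  fun _ ht => (hasDerivAt_invSqrtGap J ht).continuousAt.continuousWithinAt

/-- `g` is monotone on `[0, 1)`. [folklore] -/
theorem monotoneOn_invSqrtGap (J : ℕ) : MonotoneOn (invSqrtGap J) (Ico 0 1) := by
  refine monotoneOn_of_hasDerivWithinAt_nonneg (convex_Ico 0 1)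
    (f' := fun t => (2 * (J : ℝ) + 1) * invSqrtCoeff J * t ^ J / (2 * √(1 - t)))
    ((continuousOn_invSqrtGap J).mono Ico_subset_Iio_self) (fun t ht => ?_) (fun t ht => ?_)
  · rw [interior_Ico] at ht ⊢
    exact (hasDerivAt_invSqrtGap J ht.2).hasDerivWithinAt
  · rw [interior_Ico] at ht
    have hs : 0 < √(1 - t) := sqrt_pos.mpr (by linarith [ht.2])
    have := invSqrtCoeff_pos J
    have : 0 ≤ t ^ J := pow_nonneg ht.1.le J
    positivity

/-- LOWER bracket: `B_J(y) ≤ (√(1-y))⁻¹` for `0 ≤ y < 1`. [folklore] -/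
theorem invSqrtPartial_le_inv_sqrt (J : ℕ) {y : ℝ} (hy0 : 0 ≤ y) (hy1 : y < 1) :
    invSqrtPartial J y ≤ (√(1 - y))⁻¹ := by
  have hg : 0 ≤ invSqrtGap J y := by
    rw [← invSqrtGap_zero J]
    exact monotoneOn_invSqrtGap J ⟨le_rfl, zero_lt_one⟩ ⟨hy0, hy1⟩ hy0
  have hs : 0 < √(1 - y) := sqrt_pos.mpr (by linarith)
  have hPs : √(1 - y) * invSqrtPartial J y ≤ 1 := by
    unfold invSqrtGap at hg; linarith
  calc invSqrtPartial J y = (√(1 - y) * invSqrtPartial J y) / √(1 - y) := by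
        field_simp
    _ ≤ 1 / √(1 - y) := by gcongr
    _ = (√(1 - y))⁻¹ := one_div _

/-- UPPER bracket: `(√(1-y))⁻¹ ≤ B_J(y) + β_{J+1} y^{J+1} / (1-y)` for `0 ≤ y < 1`. [folklore] -/
theorem inv_sqrt_le_invSqrtPartial_add (J : ℕ) {y : ℝ} (hy0 : 0 ≤ y) (hy1 : y < 1) :
    (√(1 - y))⁻¹ ≤ invSqrtPartial J y + invSqrtCoeff (J + 1) * y ^ (J + 1) / (1 - y) := by
  have h1 : 0 < 1 - y := by linarith
  have hs : 0 < √(1 - y) := sqrt_pos.mpr h1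
  -- h(t) = g(t) - K t^{J+1}, K = β_{J+1}/√(1-y), is antitone on [0, y]
  set K : ℝ := invSqrtCoeff (J + 1) / √(1 - y) with hK
  let h : ℝ → ℝ := fun t => invSqrtGap J t - K * t ^ (J + 1)
  have hderiv : ∀ t, t < 1 → HasDerivAt h
      ((2 * (J : ℝ) + 1) * invSqrtCoeff J * t ^ J / (2 * √(1 - t))
        - K * (((J + 1 : ℕ) : ℝ) * t ^ J)) t := fun t ht =>
    (hasDerivAt_invSqrtGap J ht).sub ((hasDerivAt_pow (J + 1) t).const_mul K)
  have hanti : AntitoneOn h (Icc 0 y) := by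
    refine antitoneOn_of_hasDerivWithinAt_nonpos (convex_Icc 0 y)
      (f' := fun t => (2 * (J : ℝ) + 1) * invSqrtCoeff J * t ^ J / (2 * √(1 - t))
        - K * (((J + 1 : ℕ) : ℝ) * t ^ J))
      (fun t ht => ?_) (fun t ht => ?_) (fun t ht => ?_)
    · exact (hderiv t (lt_of_le_of_lt ht.2 hy1)).continuousAt.continuousWithinAt
    · rw [interior_Icc] at ht ⊢
      exact (hderiv t (lt_trans ht.2 hy1)).hasDerivWithinAt
    · rw [interior_Icc] at ht
      have hty : √(1 - y) ≤ √(1 - t) := sqrt_le_sqrt (by linarith [ht.2])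
      have hst : 0 < √(1 - t) := lt_of_lt_of_le hs hty
      have hc := invSqrtCoeff_succ J
      have hβ := invSqrtCoeff_pos J
      have htJ : 0 ≤ t ^ J := pow_nonneg ht.1.le J
      -- (J+1) K = (2J+1) β_J / (2 √(1-y))
      have hKJ : K * (((J + 1 : ℕ) : ℝ) * t ^ J)
          = (2 * (J : ℝ) + 1) * invSqrtCoeff J * t ^ J / (2 * √(1 - y)) := by
        rw [hK]; push_cast
        field_simp
        linear_combination t ^ J * hc
      rw [hKJ, sub_nonpos]
      gcongr
  have h0 : h 0 = 0 := by simp [h, invSqrtGap_zero]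
  have hy : h y ≤ 0 := by
    rw [← h0]; exact hanti ⟨le_rfl, hy0⟩ ⟨hy0, le_rfl⟩ hy0
  -- unpack: 1 - √(1-y) B ≤ K y^{J+1}
  have hmain : 1 - √(1 - y) * invSqrtPartial J y ≤ K * y ^ (J + 1) := by
    have : h y = 1 - √(1 - y) * invSqrtPartial J y - K * y ^ (J + 1) := rfl
    linarith
  rw [hK] at hmain
  have hss : √(1 - y) * √(1 - y) = 1 - y := mul_self_sqrt h1.le
  have e2 : invSqrtCoeff (J + 1) / √(1 - y) * y ^ (J + 1) / √(1 - y)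
      = invSqrtCoeff (J + 1) * y ^ (J + 1) / (1 - y) := by
    rw [div_mul_eq_mul_div, div_div, hss]
  have e3 : (√(1 - y))⁻¹ - invSqrtPartial J y
      = (1 - √(1 - y) * invSqrtPartial J y) / √(1 - y) := by
    field_simp
  have e4 : (1 - √(1 - y) * invSqrtPartial J y) / √(1 - y)
      ≤ invSqrtCoeff (J + 1) / √(1 - y) * y ^ (J + 1) / √(1 - y) :=
    div_le_div_of_nonneg_right hmain hs.le
  rw [e2] at e4
  linarith [e3, e4]

end Literature.Probability.FitznerVanDerHofstad2017
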